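import Summits.BirchSwinnertonDyer.BirchSwinnertonDyer.Theorems.GenusKolyvaginAtTwoVisiblePairAtTwoAuxClass
import HarnessLib

/-!
# Route `GenusKolyvaginAtTwo`, crux `KolyvaginExactAtTwo` (22137) → Q3-inner (24882 / 27720):
# the support conditions `hcsupp₁`, `hcsupp₂` (Lemma 4.3 for square-free depths) HOLD for the instance

Seat `bsd-line-gk2-p2` g11 (cell `bsd-f1-sign2`). THEOREMS ONLY (no definition, no named fact, no `sorry`).

The abstract exactness theorems of the pair descent (`VisiblePairHypothesesM.sel₁_eq_and_card_sel₂_eq_of_primitive`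
and its shallow-certificate variants of this seat) take as HYPOTHESES the support conditions
`hcsupp₁ : ∀ n, KolSupp Kol n → Even #pf(n) → ∀ v, (∀ q, Kol q → v ≠ pl q) → c₁ n ∈ Loc₁ v` (and `hcsupp₂` for
odd depth) — "Kolyvagin's classes are Selmer away from the primes dividing the depth" for SQUARE-FREE `n` with any
number of prime factors (the abstract structure's `dv_mul` only covers two factors). For the concrete `ℚ`-pair
instance `visiblePair I` of gk2-p3 they FOLLOW from the `Input` fields `loc_c₁_fin / loc_c₁_inf / loc_c₂_fin /
loc_c₂_inf` (Lemma 4.3 over `ℚ` at the finite places not dividing the depth and at `∞`): a finite place `w` off all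
Kolyvagin places does not divide a square-free product of Kolyvagin primes (`natCast_notMem_of_kolSupp`, prime
ideal ∌ product).

* `natCast_notMem_of_kolSupp`, `hcsupp₁_visiblePair`, `hcsupp₂_visiblePair`;
* `selmer_eq_and_card_selmer_twin_eq_of_kolPrime'` — the capstone `…_of_kolPrime` (`…AuxClass`) with
  `hcsupp₁ hcsupp₂` DISCHARGED. Still displayed there: the Cassels–Tate data over `ℚ`, `3 M₀ ≤ M`, the level-`2`
  classes `y₀, uu, w` with `h43 / h44sel / h44ord / hι`, and the `Input` record. BSD is not proved by any of this.

References: [McCallumLMS1991] W. G. McCallum, *Kolyvagin's work on Shafarevich–Tate groups*, LMS LNS 153 (1991),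
Lemma 4.3 (p. 304), Prop. 5.2; [GrossLMS1991] B. H. Gross, *Kolyvagin's work on modular elliptic curves*, §3, Prop. 6.2.
-/

set_option linter.dupNamespace false -- tree convention: `Summit.BirchSwinnertonDyer.BirchSwinnertonDyer.Theorems` (summit = sub-problem)
set_option autoImplicit false

noncomputable section

open scoped Classical

namespace Summit.BirchSwinnertonDyer.BirchSwinnertonDyer.Theorems.GenusExact.VisiblePairAtTwo

open WeierstrassCurve NumberField IsDedekindDomain Field Finset Rat.HeightOneSpectrum
open Literature.NumberTheory.EllipticCurves Literature.NumberTheory.GaloisRepresentations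
open Literature.NumberTheory.EllipticCurves.KolyvaginDescent

variable (W : WeierstrassCurve ℚ) [W.IsElliptic] [W.IsGloballyMinimal] (K : Type) [Field K] [NumberField K]
  (M : ℕ)

omit [W.IsElliptic] in
/-- **A finite place off all Kolyvagin places does not divide a square-free product of Kolyvagin primes.**
If `n` is a square-free product of Kolyvagin primes and the finite place `w` is not the place `pl q` of any
Kolyvagin prime `q`, then `(n : 𝓞 ℚ) ∉ w` (a prime ideal containing `∏ q` contains some `q`, and then `w = v_q`).
[folklore] -/
theorem natCast_notMem_of_kolSupp {n : ℕ} (hn : KolSupp (kolPrime W K M) n) (w : HeightOneSpectrum (𝓞 ℚ))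
    (hw : ∀ q, kolPrime W K M q → (Sum.inl w : HeightOneSpectrum (𝓞 ℚ) ⊕ InfinitePlace ℚ) ≠ pl q) :
    (n : 𝓞 ℚ) ∉ w.asIdeal := by
  intro hmem
  rw [← Nat.prod_primeFactors_of_squarefree hn.1, Nat.cast_prod] at hmem
  obtain ⟨q, hq, hqw⟩ := (Ideal.IsPrime.prod_mem_iff (hp := w.isPrime)).mp hmem
  have hqp : q.Prime := Nat.prime_of_mem_primeFactors hq
  exact hw q (hn.2 q hq) (by rw [pl_of_prime hqp, (natCast_prime_mem_iff_eq hqp w).mp hqw])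

variable {W} {K} {M} {θ : K} {hθ : θ ∉ Set.range (algebraMap ℚ K)}
  {hθsq : θ ^ 2 = algebraMap ℚ K ((NumberField.discr K : ℤ) : ℚ)}

/-- **`hcsupp₁` HOLDS for `visiblePair I`** (Lemma 4.3, even depth): Kolyvagin's class `c₁ n` of a square-free
product `n` of Kolyvagin primes is Selmer at every place that is not the place of a Kolyvagin prime — from the
`Input` fields `loc_c₁_fin` (finite places not dividing `n`) and `loc_c₁_inf` (the infinite place).
[cite: McCallumLMS1991, Lemma 4.3 (p. 304)] -/
theorem hcsupp₁_visiblePair (I : Input W K M hθ hθsq) [(twin W K).IsElliptic] :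
    ∀ n, KolSupp (visiblePair I).Kol n → Even n.primeFactors.card →
      ∀ v, (∀ q, (visiblePair I).Kol q → v ≠ (visiblePair I).pl q) →
        (visiblePair I).c₁ n ∈ (visiblePair I).Loc₁ v := by
  intro n hn hev v hv
  cases v with
  | inl w => exact I.loc_c₁_fin n hn hev w (natCast_notMem_of_kolSupp W K M hn w hv)
  | inr σ => exact I.loc_c₁_inf n hn hev σ

/-- **`hcsupp₂` HOLDS for `visiblePair I`** (Lemma 4.3, odd depth, on the twin `E^{(d_K)}`): from the `Input`
fields `loc_c₂_fin` and `loc_c₂_inf`. [cite: McCallumLMS1991, Lemma 4.3 (p. 304)] -/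
theorem hcsupp₂_visiblePair (I : Input W K M hθ hθsq) [(twin W K).IsElliptic] :
    ∀ n, KolSupp (visiblePair I).Kol n → Odd n.primeFactors.card →
      ∀ v, (∀ q, (visiblePair I).Kol q → v ≠ (visiblePair I).pl q) →
        (visiblePair I).c₂ n ∈ (visiblePair I).Loc₂ v := by
  intro n hn hodd v hv
  cases v with
  | inl w => exact I.loc_c₂_fin n hn hodd w (natCast_notMem_of_kolSupp W K M hn w hv)
  | inr σ => exact I.loc_c₂_inf n hn hodd σ

/-- **Exactness of `visiblePair I` from a SHALLOW Kolyvagin prime — visibility (H2), the auxiliary class AND the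
support conditions discharged.** Same conclusion as `selmer_eq_and_card_selmer_twin_eq_of_kolPrime`
(`Sel_{2^M}(E/ℚ) = ℤ·x`, `#Sel_{2^M}(E^{(d_K)}/ℚ) = 2^{2 M₀}`), with `hcsupp₁ hcsupp₂` now supplied by
`hcsupp₁_visiblePair / hcsupp₂_visiblePair`. Still displayed: the Cassels–Tate data `P₁ P₂ halt hPx hnd hCTV` over
`ℚ`, `3 M₀ ≤ M`, the bottom-level classes `y₀` (Selmer, `≠ 0`), `uu`, `w` with Lemma 4.3 off `{ℓ₀, ℓ}` (`h43`),
Prop. 4.4 at level `2` (`h44sel`, `h44ord`) and Lemma 4.6 (`hι`), and the `Input` record `I` of gk2-p3.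
[cite: McCallumLMS1991, Prop. 5.2 (pp. 308–310), Lemma 4.3, Lemma 5.3, Thm. 5.4] -/
theorem selmer_eq_and_card_selmer_twin_eq_of_kolPrime' (I : Input W K M hθ hθsq) (hcm : ¬ W.HasCM)
    (hΔ : W.Δ < 0) (hK : IsImaginaryQuadratic K) (hodd : Odd (NumberField.discr K))
    (hns : ¬ IsSquare ((NumberField.discr K : ℚ) * -|W.Δ|))
    (hρ : ∀ n : ℕ, W.HasSurjectiveModNGaloisRep (2 ^ n : ℕ)) [(twin W K).IsElliptic] (hM : 1 ≤ M)
    (P₁ : (visiblePair I).Sel₁ →+ (visiblePair I).Sel₁ →+ AddCircle (1 : ℚ)) (halt₁ : ∀ z, P₁ z z = 0)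
    (hPx : ∀ t, P₁ ⟨(visiblePair I).x, (visiblePair I).x_mem⟩ t = 0)
    (hnd₁ : ∀ z : (visiblePair I).Sel₁, (∀ t, P₁ z t = 0) →
      (z : galH1Torsion W (lvl M)) ∈ AddSubgroup.zmultiples (visiblePair I).x)
    (P₂ : (visiblePair I).Sel₂ →+ (visiblePair I).Sel₂ →+ AddCircle (1 : ℚ)) (halt₂ : ∀ z, P₂ z z = 0)
    (hnd₂ : ∀ z : (visiblePair I).Sel₂, (∀ t, P₂ z t = 0) → z = 0)
    (hCTV : ∀ ℓ m : ℕ, (visiblePair I).Kol ℓ → KolSupp (visiblePair I).Kol (ℓ * m) → ¬ ℓ ∣ m →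
      ∀ (j N a b : ℕ) (t : galH1Torsion W (lvl M) × galH1Torsion (twin W K) (lvl M))
        (ht : t ∈ (visiblePair I).toVisibleSplit.Sel)
        (hz : (((visiblePair I).p : ℤ) ^ j) • (visiblePair I).toVisibleSplit.c (ℓ * m) ∈
          (visiblePair I).toVisibleSplit.Sel),
      (((visiblePair I).p : ℤ) ^ N) • t = 0 →
      t ∈ (visiblePair I).toVisibleSplit.part (1 * (-1) ^ (ℓ * m).primeFactors.card) →
      (∀ q ∈ m.primeFactors, t ∈ (visiblePair I).toVisibleSplit.A q) →
      (visiblePair I).M - (visiblePair I).M₀ ≤ j → N + (visiblePair I).M₀ ≤ (visiblePair I).M → N ≤ j →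
      a + b + 1 = N →
      (((visiblePair I).p : ℤ) ^ (a + (j - N))) • (visiblePair I).toVisibleSplit.c m ∉
        (visiblePair I).toVisibleSplit.A ℓ →
      (((visiblePair I).p : ℤ) ^ b) • t ∉ (visiblePair I).toVisibleSplit.A ℓ →
      (visiblePair I).prodPairing P₁ P₂ ⟨_, hz⟩ ⟨t, ht⟩ ≠ 0)
    (h3 : 3 * I.M₀ ≤ M)
    -- the shallow certificate and its level-`2` data
    {ℓ₀ : ℕ} (hkol₀ : kolPrime W K 1 ℓ₀) (y₀ : galH1Torsion (twin W K) (lvl 1)) (hy0 : y₀ ≠ 0)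
    (hy : y₀ ∈ selmerGroup (twin W K) (lvl 1))
    (uu : ℕ → galH1Torsion W (lvl 1)) (w : ℕ → galH1Torsion (twin W K) (lvl 1))
    (h43 : ∀ ℓ, kolPrime W K M ℓ → ℓ ≠ ℓ₀ → ∀ v, v ≠ pl ℓ₀ → v ≠ pl ℓ → uu ℓ ∈ loc₁ W 1 v)
    (h44sel : ∀ ℓ, kolPrime W K M ℓ → ℓ ≠ ℓ₀ → (uu ℓ ∈ loc₁ W 1 (pl ℓ) ↔ y₀ ∈ a₂ W K 1 ℓ))
    (h44ord : ∀ ℓ, kolPrime W K M ℓ → ℓ ≠ ℓ₀ → (uu ℓ ∈ a₁ W 1 ℓ₀ ↔ w ℓ ∈ a₂ W K 1 ℓ₀))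
    (hι : ∀ ℓ, kolPrime W K M ℓ →
      torsionH1OfDvd (twin W K) (lvl_one_dvd_lvl hM) (w ℓ) = ((2 : ℤ) ^ (M - 1)) • I.c₂ ℓ) :
    selmerGroup W (lvl M) = AddSubgroup.zmultiples I.x ∧
      Nat.card (selmerGroup (twin W K) (lvl M)) = 2 ^ (2 * I.M₀) :=
  selmer_eq_and_card_selmer_twin_eq_of_kolPrime I hcm hΔ hK hodd hns hρ hM P₁ halt₁ hPx hnd₁ P₂ halt₂ hnd₂ hCTV
    (hcsupp₁_visiblePair I) (hcsupp₂_visiblePair I) h3 hkol₀ y₀ hy0 hy uu w h43 h44sel h44ord hι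

/-! ### The same capstone with the value formula restricted to `2^{2M₀}`-torsion classes

Appended by seat `bsd-line-gk2-p2` g12: `selmer_eq_and_card_selmer_twin_eq_of_kolPrime'` VERBATIM, with `hCTV` assumed only for `t` with
`2^{2M₀} t = 0` — the only classes the telescope applies it to (Selmer eigenclasses independent of `x`,
Literature `exists_chain_of_casselsTate_of_torsion`), and the form in which the Cassels–Tate pairings pulled
back to `Sel_{2^M}` actually satisfy it. -/

/-- **`selmer_eq_and_card_selmer_twin_eq_of_kolPrime'`, value formula on `2^{2M₀}`-torsion classes only** (extra antecedent
`2^{2M₀} t = 0` in `hCTV`; everything else verbatim). [cite: McCallumLMS1991, Prop. 5.2, Thm. 5.4, Cor. 5.6]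
[cite: Kolyvagin1989Izv, §3] -/
theorem selmer_eq_and_card_selmer_twin_eq_of_kolPrime_of_torsion' (I : Input W K M hθ hθsq) (hcm : ¬ W.HasCM)
    (hΔ : W.Δ < 0) (hK : IsImaginaryQuadratic K) (hodd : Odd (NumberField.discr K))
    (hns : ¬ IsSquare ((NumberField.discr K : ℚ) * -|W.Δ|))
    (hρ : ∀ n : ℕ, W.HasSurjectiveModNGaloisRep (2 ^ n : ℕ)) [(twin W K).IsElliptic] (hM : 1 ≤ M)
    (P₁ : (visiblePair I).Sel₁ →+ (visiblePair I).Sel₁ →+ AddCircle (1 : ℚ)) (halt₁ : ∀ z, P₁ z z = 0)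
    (hPx : ∀ t, P₁ ⟨(visiblePair I).x, (visiblePair I).x_mem⟩ t = 0)
    (hnd₁ : ∀ z : (visiblePair I).Sel₁, (∀ t, P₁ z t = 0) →
      (z : galH1Torsion W (lvl M)) ∈ AddSubgroup.zmultiples (visiblePair I).x)
    (P₂ : (visiblePair I).Sel₂ →+ (visiblePair I).Sel₂ →+ AddCircle (1 : ℚ)) (halt₂ : ∀ z, P₂ z z = 0)
    (hnd₂ : ∀ z : (visiblePair I).Sel₂, (∀ t, P₂ z t = 0) → z = 0)
    (hCTV : ∀ ℓ m : ℕ, (visiblePair I).Kol ℓ → KolSupp (visiblePair I).Kol (ℓ * m) → ¬ ℓ ∣ m →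
      ∀ (j N a b : ℕ) (t : galH1Torsion W (lvl M) × galH1Torsion (twin W K) (lvl M))
        (ht : t ∈ (visiblePair I).toVisibleSplit.Sel)
        (hz : (((visiblePair I).p : ℤ) ^ j) • (visiblePair I).toVisibleSplit.c (ℓ * m) ∈
          (visiblePair I).toVisibleSplit.Sel),
      (((visiblePair I).p : ℤ) ^ N) • t = 0 → (((visiblePair I).p : ℤ) ^ (2 * (visiblePair I).M₀)) • t = 0 →
      t ∈ (visiblePair I).toVisibleSplit.part (1 * (-1) ^ (ℓ * m).primeFactors.card) →
      (∀ q ∈ m.primeFactors, t ∈ (visiblePair I).toVisibleSplit.A q) →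
      (visiblePair I).M - (visiblePair I).M₀ ≤ j → N + (visiblePair I).M₀ ≤ (visiblePair I).M → N ≤ j →
      a + b + 1 = N →
      (((visiblePair I).p : ℤ) ^ (a + (j - N))) • (visiblePair I).toVisibleSplit.c m ∉
        (visiblePair I).toVisibleSplit.A ℓ →
      (((visiblePair I).p : ℤ) ^ b) • t ∉ (visiblePair I).toVisibleSplit.A ℓ →
      (visiblePair I).prodPairing P₁ P₂ ⟨_, hz⟩ ⟨t, ht⟩ ≠ 0)
    (h3 : 3 * I.M₀ ≤ M)
    -- the shallow certificate and its level-`2` data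
    {ℓ₀ : ℕ} (hkol₀ : kolPrime W K 1 ℓ₀) (y₀ : galH1Torsion (twin W K) (lvl 1)) (hy0 : y₀ ≠ 0)
    (hy : y₀ ∈ selmerGroup (twin W K) (lvl 1))
    (uu : ℕ → galH1Torsion W (lvl 1)) (w : ℕ → galH1Torsion (twin W K) (lvl 1))
    (h43 : ∀ ℓ, kolPrime W K M ℓ → ℓ ≠ ℓ₀ → ∀ v, v ≠ pl ℓ₀ → v ≠ pl ℓ → uu ℓ ∈ loc₁ W 1 v)
    (h44sel : ∀ ℓ, kolPrime W K M ℓ → ℓ ≠ ℓ₀ → (uu ℓ ∈ loc₁ W 1 (pl ℓ) ↔ y₀ ∈ a₂ W K 1 ℓ))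
    (h44ord : ∀ ℓ, kolPrime W K M ℓ → ℓ ≠ ℓ₀ → (uu ℓ ∈ a₁ W 1 ℓ₀ ↔ w ℓ ∈ a₂ W K 1 ℓ₀))
    (hι : ∀ ℓ, kolPrime W K M ℓ →
      torsionH1OfDvd (twin W K) (lvl_one_dvd_lvl hM) (w ℓ) = ((2 : ℤ) ^ (M - 1)) • I.c₂ ℓ) :
    selmerGroup W (lvl M) = AddSubgroup.zmultiples I.x ∧
      Nat.card (selmerGroup (twin W K) (lvl M)) = 2 ^ (2 * I.M₀) :=
  selmer_eq_and_card_selmer_twin_eq_of_kolPrime_of_torsion I hcm hΔ hK hodd hns hρ hM P₁ halt₁ hPx hnd₁ P₂ halt₂ hnd₂ hCTV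
    (hcsupp₁_visiblePair I) (hcsupp₂_visiblePair I) h3 hkol₀ y₀ hy0 hy uu w h43 h44sel h44ord hι

end Summit.BirchSwinnertonDyer.BirchSwinnertonDyer.Theorems.GenusExact.VisiblePairAtTwo
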